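import Literature.Probability.RandomPlanarGeometry.SAWCountZdSymbolTopShapes
import Literature.MathematicalPhysics.QuantumFieldTheory.Balaban1983to89.HiggsFluctMeasureWickPairings
import HarnessLib

/-!
# The TOP shape classes of `R_j`, part 2: the data of a top shape — a perfect matching of the outside letters and `2j − 2` free signs; the built word

Topic `Literature/Probability/RandomPlanarGeometry` (car λ «LEADING SHAPE COEFFICIENT», part 2 of 4; continues `SAWCountZdSymbolTopShapes.lean`; uses the
tree's perfect matchings of record `HiggsFluctMeasureWickPairings.pairPartitions` with ★ `card_pairPartitions_of_card_eq_two_mul` (Glimm–Jaffe (3.2.13):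
`(2n − 1)!!` pairings of `2n` legs) and p13's set partitions `Literature.Probability.LatticeModels.{IsSetPartition, blockOf}` (`HardCoreUrsell`)).

PRINTED CONTEXT (locators only; nothing is quoted digit-for-digit). Madras–Slade (1993) §1.1 eq. (1.1.8) p. 5 (the `1/d` expansion of `μ` after
Fisher–Sykes / Fisher–Gaunt, "although there is no rigorous control of their error term"), Definition 1.2.4, §1.2 p. 10; Clisby–Liang–Slade (2007) §3.3
eqs. (29)/(31) (enumerations decomposed by the number of dimensions explored). NOT IN PRINT as far as the lane's desks could locate (lit-1 g30 / lit-2 g31,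
2026-08-27; FINDING-ZD-SYMBOL-POLYNOMIALITY §6(b)): the statements below (lane theorems about the lane's own symbol polynomial `R_j = symbolPoly j` of
`SAWCountZdSymbolPolynomiality.lean`, a-p1 g22, and its shape classes `shapeClass j u A` of `SAWCountZdRepeatSetShapes.lean`).

THE CONSTRUCTION (this file). Fix the block position `p` (`p + 4 ≤ m`). A TOP DATUM is a pair (`π`, `S`): `π` a partition of the `m − 4` positions
outside `[p, p+4)` into pairs (`pairPartitions (outside m p)`), `S` a subset of the `m − 2` positions other than `p+2, p+3` (`topData m p`). Its word
`mkWord hp π S` gives the block letters the axes `p, p+1, p, p+1` and the signs `s, t, ¬s, ¬t` (`s, t` read off `S`), and an outside letter the least element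
of its pair as axis and its membership in `S` as sign; ★ `axisOf_eq_iff` (two positions share an axis iff same block parity or same pair), `axCls_mkWord`,
`two_mul_numAxes_mkWord` (`m/2` axes), `isRep_mkWord`, `bsumW_mkWord` (the block sums to zero), and ★★ `canon_mkWord_mem_shapeClass`: the canonical renaming
`canon (mkWord hp π S)` IS a top shape, `∈ shapeClass j (2j) (topVec (2j) p)`.
Tool notions (the lane's): `InB`, `axisOf`, `signOf`, `mkWord`, `outside`, `freePos`, `topData`.

THIS FILE (lane «pcv-sawmu», a-p1 g25; all PROVED, standard axioms): `InB`, `axisOf`, `signOf`, `mkWord`, `outside`, `freePos`, `topData`, `mem_outside`,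
`blockOf_facts`, `axisOf_of_not_inB`, ★ `axisOf_eq_iff`, `axCls_mkWord`, `card_axCls_mkWord`, `two_mul_numAxes_mkWord`, `isRep_mkWord`, `bsumW_mkWord`,
★★ `canon_mkWord_mem_shapeClass`.
[cite: MadrasSlade1993, §1.1 eq. (1.1.8) p. 5; Definition 1.2.4; §1.2 (p. 10)] [cite: ClisbyLiangSlade2007, §3.3 eqs. (29)/(31)] [cite: GlimmJaffeQP1987, (3.2.13) §3.2]

Provenance: lane «pcv-sawmu», a-p1 g25 (2026-08-28).
-/

open Finset
open scoped BigOperators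
open Literature.Probability.LatticeModels
open Literature.Probability.RandomPlanarGeometry.SAW
open Literature.Probability.Percolation
open Literature.MathematicalPhysics.QuantumFieldTheory.Balaban1983to89

namespace Literature.Probability.RandomPlanarGeometry.SAW.Zd

namespace WordTypes

variable {m : ℕ}

/-! ### The data of a top shape: a perfect matching of the letters outside the block, and free signs off `p+2, p+3` -/

section Data

variable {p : ℕ}

/-- Inside the block `[p, p+4)`. [cite: MadrasSlade1993, Definition 1.2.4; lane tool notion] -/
def InB (p : ℕ) (q : Fin m) : Prop := p ≤ q.val ∧ q.val ≤ p + 3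

open Classical in
/-- The axis of position `q` in the word built from a matching `π` of the outside letters: block letters `p, p+2 ↦ p`, `p+1, p+3 ↦ p+1`,
an outside letter `↦` the least element of its block of `π`. [cite: MadrasSlade1993, Definition 1.2.4; lane tool notion] -/
noncomputable def axisOf (hp : p + 4 ≤ m) (π : Finset (Finset (Fin m))) (q : Fin m) : Fin m :=
  if InB p q then (if (q.val - p) % 2 = 0 then ⟨p, by omega⟩ else ⟨p + 1, by omega⟩)
  else if h : (blockOf π q).Nonempty then (blockOf π q).min' h else q

/-- The sign of position `q` in the word built from a sign set `S`: free off `p+2, p+3`, forced opposite there.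
[cite: MadrasSlade1993, Definition 1.2.4; lane tool notion] -/
def signOf (hp : p + 4 ≤ m) (S : Finset (Fin m)) (q : Fin m) : Bool :=
  if q.val = p + 2 then !(decide ((⟨p, by omega⟩ : Fin m) ∈ S))
  else if q.val = p + 3 then !(decide ((⟨p + 1, by omega⟩ : Fin m) ∈ S)) else decide (q ∈ S)

/-- The word of a (matching, sign set) datum (before canonical renaming). [cite: MadrasSlade1993, Definition 1.2.4; lane tool notion] -/
noncomputable def mkWord (hp : p + 4 ≤ m) (π : Finset (Finset (Fin m))) (S : Finset (Fin m)) : Word m m :=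
  fun q => (axisOf hp π q, signOf hp S q)

open Classical in
/-- The positions outside the block. [cite: MadrasSlade1993, Definition 1.2.4; lane tool notion] -/
noncomputable def outside (m p : ℕ) : Finset (Fin m) := Finset.univ.filter fun q => ¬ InB p q

open Classical in
/-- The free sign positions: all but `p+2`, `p+3`. [cite: MadrasSlade1993, Definition 1.2.4; lane tool notion] -/
def freePos (m p : ℕ) : Finset (Fin m) := Finset.univ.filter fun q => q.val ≠ p + 2 ∧ q.val ≠ p + 3

/-- The TOP DATA: perfect matchings of the outside positions × sign sets on the free positions.
[cite: MadrasSlade1993, Definition 1.2.4; lane tool notion] -/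
noncomputable def topData (m p : ℕ) : Finset (Finset (Finset (Fin m)) × Finset (Fin m)) :=
  HiggsFluctMeasureWickPairings.pairPartitions (outside m p) ×ˢ (freePos m p).powerset

/-- Membership in `outside`. [cite: MadrasSlade1993, Definition 1.2.4; lane plumbing] -/
theorem mem_outside {q : Fin m} : q ∈ outside m p ↔ ¬ InB p q := by
  classical
  simp [outside]

/-- For a matching `π` of the outside positions and `q` outside: `blockOf π q ∈ π`, `q ∈ blockOf π q ⊆ outside`, `#blockOf π q = 2`.
[cite: MadrasSlade1993, Definition 1.2.4; lane plumbing] -/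
theorem blockOf_facts {π : Finset (Finset (Fin m))} (hπ : π ∈ HiggsFluctMeasureWickPairings.pairPartitions (outside m p))
    {q : Fin m} (hq : ¬ InB p q) :
    blockOf π q ∈ π ∧ q ∈ blockOf π q ∧ blockOf π q ⊆ outside m p ∧ (blockOf π q).card = 2 := by
  rw [HiggsFluctMeasureWickPairings.mem_pairPartitions] at hπ
  have hqO : q ∈ outside m p := mem_outside.2 hq
  refine ⟨hπ.1.blockOf_mem hqO, hπ.1.mem_blockOf hqO, hπ.1.subset (hπ.1.blockOf_mem hqO), hπ.2 _ (hπ.1.blockOf_mem hqO)⟩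

/-- The axis of an outside position is the least element of its block; it lies outside the block `[p, p+4)`.
[cite: MadrasSlade1993, Definition 1.2.4; lane plumbing] -/
theorem axisOf_of_not_inB (hp : p + 4 ≤ m) {π : Finset (Finset (Fin m))}
    (hπ : π ∈ HiggsFluctMeasureWickPairings.pairPartitions (outside m p)) {q : Fin m} (hq : ¬ InB p q) :
    axisOf hp π q = (blockOf π q).min' ⟨q, (blockOf_facts hπ hq).2.1⟩ ∧ ¬ InB p (axisOf hp π q) := by
  have hne : (blockOf π q).Nonempty := ⟨q, (blockOf_facts hπ hq).2.1⟩
  have h1 : axisOf hp π q = (blockOf π q).min' hne := by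
    unfold axisOf; rw [if_neg hq, dif_pos hne]
  refine ⟨h1, ?_⟩
  rw [h1]
  exact mem_outside.1 ((blockOf_facts hπ hq).2.2.1 (Finset.min'_mem _ hne))

/-- ★ THE AXIS RELATION OF `mkWord`: two positions share an axis iff both are in the block with the same parity, or both are outside in
the same block of the matching. [cite: MadrasSlade1993, Definition 1.2.4; lane lemma] -/
theorem axisOf_eq_iff (hp : p + 4 ≤ m) {π : Finset (Finset (Fin m))}
    (hπ : π ∈ HiggsFluctMeasureWickPairings.pairPartitions (outside m p)) (q q' : Fin m) :
    axisOf hp π q = axisOf hp π q' ↔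
      (InB p q ∧ InB p q' ∧ (q.val - p) % 2 = (q'.val - p) % 2) ∨ (¬ InB p q ∧ ¬ InB p q' ∧ blockOf π q = blockOf π q') := by
  by_cases hq : InB p q <;> by_cases hq' : InB p q'
  · -- both inside
    have e : ∀ r : Fin m, InB p r → axisOf hp π r = if (r.val - p) % 2 = 0 then ⟨p, by omega⟩ else ⟨p + 1, by omega⟩ := by
      intro r hr; unfold axisOf; rw [if_pos hr]
    rw [e q hq, e q' hq']
    constructor
    · intro h
      refine Or.inl ⟨hq, hq', ?_⟩
      split_ifs at h with h1 h2 h2 <;> simp [Fin.ext_iff] at h <;> omega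
    · rintro (⟨-, -, h⟩ | ⟨h, -⟩)
      · rw [h]
      · exact absurd hq h
  · -- q inside, q' outside
    have h2 := (axisOf_of_not_inB hp hπ hq').2
    have h1 : InB p (axisOf hp π q) := by
      unfold axisOf; rw [if_pos hq]; unfold InB; split_ifs <;> simp
    constructor
    · intro h; rw [h] at h1; exact absurd h1 h2
    · rintro (⟨-, h, -⟩ | ⟨h, -⟩); exacts [absurd h hq', absurd hq h]
  · -- q outside, q' inside
    have h2 := (axisOf_of_not_inB hp hπ hq).2
    have h1 : InB p (axisOf hp π q') := by
      unfold axisOf; rw [if_pos hq']; unfold InB; split_ifs <;> simp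
    constructor
    · intro h; rw [← h] at h1; exact absurd h1 h2
    · rintro (⟨h, -, -⟩ | ⟨-, h, -⟩); exacts [absurd h hq, absurd hq' h]
  · -- both outside
    rw [(axisOf_of_not_inB hp hπ hq).1, (axisOf_of_not_inB hp hπ hq').1]
    constructor
    · intro h
      refine Or.inr ⟨hq, hq', ?_⟩
      -- the minima coincide, so the blocks share an element
      have hm1 : (blockOf π q).min' ⟨q, (blockOf_facts hπ hq).2.1⟩ ∈ blockOf π q := Finset.min'_mem _ _
      have hm2 : (blockOf π q').min' ⟨q', (blockOf_facts hπ hq').2.1⟩ ∈ blockOf π q' := Finset.min'_mem _ _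
      rw [h] at hm1
      rw [HiggsFluctMeasureWickPairings.mem_pairPartitions] at hπ
      exact hπ.1.eq_of_mem (blockOf_facts (HiggsFluctMeasureWickPairings.mem_pairPartitions.2 hπ) hq).1
        (blockOf_facts (HiggsFluctMeasureWickPairings.mem_pairPartitions.2 hπ) hq').1 hm1 hm2
    · rintro (⟨h, -, -⟩ | ⟨-, -, h⟩)
      · exact absurd h hq
      · simp only [h]

end Data

section Build

variable {p : ℕ}

open Classical in
/-- The axis classes of `mkWord`: the parity class inside the block, the matching block outside.
[cite: MadrasSlade1993, Definition 1.2.4; lane lemma] -/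
theorem axCls_mkWord (hp : p + 4 ≤ m) {π : Finset (Finset (Fin m))}
    (hπ : π ∈ HiggsFluctMeasureWickPairings.pairPartitions (outside m p)) (S : Finset (Fin m)) (q : Fin m) :
    axCls (mkWord hp π S) q =
      if InB p q then ({⟨p + (q.val - p) % 2, by omega⟩, ⟨p + (q.val - p) % 2 + 2, by omega⟩} : Finset (Fin m))
      else blockOf π q := by
  classical
  ext r
  rw [mem_axCls]
  change axisOf hp π r = axisOf hp π q ↔ _
  rw [axisOf_eq_iff hp hπ]
  split_ifs with hq
  · simp only [Finset.mem_insert, Finset.mem_singleton, Fin.ext_iff]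
    constructor
    · rintro (⟨hr, -, h⟩ | ⟨-, h, -⟩)
      · unfold InB at hr hq; omega
      · exact absurd hq h
    · intro h
      refine Or.inl ⟨?_, hq, ?_⟩
      · unfold InB at hq ⊢; omega
      · unfold InB at hq; omega
  · constructor
    · rintro (⟨-, h, -⟩ | ⟨hr, -, h⟩)
      · exact absurd h hq
      · rw [← h]; exact (blockOf_facts hπ hr).2.1
    · intro h
      have hrO : ¬ InB p r := mem_outside.1 ((blockOf_facts hπ hq).2.2.1 h)
      refine Or.inr ⟨hrO, hq, ?_⟩
      rw [HiggsFluctMeasureWickPairings.mem_pairPartitions] at hπ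
      exact hπ.1.eq_blockOf (hπ.1.blockOf_mem (mem_outside.2 hq)) h

/-- Every axis class of `mkWord` has exactly two elements. [cite: MadrasSlade1993, Definition 1.2.4; lane lemma] -/
theorem card_axCls_mkWord (hp : p + 4 ≤ m) {π : Finset (Finset (Fin m))}
    (hπ : π ∈ HiggsFluctMeasureWickPairings.pairPartitions (outside m p)) (S : Finset (Fin m)) (q : Fin m) :
    (axCls (mkWord hp π S) q).card = 2 := by
  rw [axCls_mkWord hp hπ S q]
  split_ifs with hq
  · exact Finset.card_pair (by simp [Fin.ext_iff])
  · exact (blockOf_facts hπ hq).2.2.2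

/-- `mkWord` uses exactly `m / 2` axes. [cite: MadrasSlade1993, Definition 1.2.4; lane lemma] -/
theorem two_mul_numAxes_mkWord (hp : p + 4 ≤ m) {π : Finset (Finset (Fin m))}
    (hπ : π ∈ HiggsFluctMeasureWickPairings.pairPartitions (outside m p)) (S : Finset (Fin m)) :
    2 * numAxes (mkWord hp π S) = m := by
  classical
  rw [numAxes_eq_card_image]
  have hsum := Finset.card_eq_sum_card_image (fun q : Fin m => (mkWord hp π S q).1) Finset.univ
  rw [Finset.card_univ, Fintype.card_fin] at hsum
  have h2 : ∀ x ∈ Finset.univ.image (fun q : Fin m => (mkWord hp π S q).1),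
      (Finset.univ.filter fun q' : Fin m => (mkWord hp π S q').1 = x).card = 2 := by
    intro x hx
    obtain ⟨q, -, rfl⟩ := Finset.mem_image.1 hx
    exact card_axCls_mkWord hp hπ S q
  rw [Finset.sum_congr rfl h2, Finset.sum_const, smul_eq_mul] at hsum
  omega

/-- Every position of `mkWord` is repeated. [cite: MadrasSlade1993, Definition 1.2.4; lane lemma] -/
theorem isRep_mkWord (hp : p + 4 ≤ m) {π : Finset (Finset (Fin m))}
    (hπ : π ∈ HiggsFluctMeasureWickPairings.pairPartitions (outside m p)) (S : Finset (Fin m)) (q : Fin m) :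
    IsRep (mkWord hp π S) q := by
  classical
  have h2 := card_axCls_mkWord hp hπ S q
  obtain ⟨a, b, hab, hcls⟩ := Finset.card_eq_two.1 h2
  have hq : q ∈ ({a, b} : Finset (Fin m)) := hcls ▸ self_mem_axCls _ q
  have ha : a ∈ axCls (mkWord hp π S) q := hcls ▸ (by simp)
  have hb : b ∈ axCls (mkWord hp π S) q := hcls ▸ (by simp)
  rw [Finset.mem_insert, Finset.mem_singleton] at hq
  rcases hq with rfl | rfl
  · exact ⟨b, hab.symm, mem_axCls.1 hb⟩
  · exact ⟨a, hab, mem_axCls.1 ha⟩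

/-- The block of `mkWord` sums to zero: `bsumW (mkWord …) p (p + 4) = 0`. [cite: MadrasSlade1993, Definition 1.2.4; lane lemma] -/
theorem bsumW_mkWord (hp : p + 4 ≤ m) (π : Finset (Finset (Fin m))) (S : Finset (Fin m)) :
    bsumW (mkWord hp π S) p (p + 4) = 0 := by
  classical
  unfold bsumW
  have ht : (Finset.univ.filter fun q : Fin m => p ≤ q.val ∧ q.val < p + 4) =
      ({⟨p, by omega⟩, ⟨p + 1, by omega⟩, ⟨p + 2, by omega⟩, ⟨p + 3, by omega⟩} : Finset (Fin m)) := by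
    ext q
    simp only [Finset.mem_filter, Finset.mem_univ, true_and, Finset.mem_insert, Finset.mem_singleton, Fin.ext_iff]
    omega
  rw [ht, Finset.sum_insert (by simp [Fin.ext_iff]), Finset.sum_insert (by simp [Fin.ext_iff]),
    Finset.sum_pair (by simp [Fin.ext_iff])]
  -- the letters at `p+2`, `p+3` are the reversals of those at `p`, `p+1`
  have e2 : mkWord hp π S ⟨p + 2, by omega⟩ = revIdx (mkWord hp π S ⟨p, by omega⟩) := by
    unfold mkWord revIdx axisOf signOf InB
    simp
  have e3 : mkWord hp π S ⟨p + 3, by omega⟩ = revIdx (mkWord hp π S ⟨p + 1, by omega⟩) := by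
    unfold mkWord revIdx axisOf signOf InB
    simp
  rw [e2, e3, twoStepV_revIdx, twoStepV_revIdx]
  abel

end Build

section Member

variable {p : ℕ}

/-- ★ THE BUILT WORD IS A TOP SHAPE: `canon (mkWord hp π S) ∈ shapeClass j (2j) (topVec (2j) p)` for every matching `π` of the outside
positions and every sign set `S`. [cite: MadrasSlade1993, Definition 1.2.4; lane lemma] -/
theorem canon_mkWord_mem_shapeClass {j : ℕ} (hm : m = 2 * j) (hp : p + 4 ≤ m) {π : Finset (Finset (Fin m))}
    (hπ : π ∈ HiggsFluctMeasureWickPairings.pairPartitions (outside m p)) (S : Finset (Fin m)) :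
    canon (mkWord hp π S) ∈ shapeClass j m (topVec m p) := by
  classical
  have hst : SameType (mkWord hp π S) (canon (mkWord hp π S)) := sameType_canon _
  unfold shapeClass
  simp only [Finset.mem_filter, Finset.mem_univ, true_and]
  refine ⟨hst.symm.canon_eq, ?_, fun i => (hst.isRep_iff i).1 (isRep_mkWord hp hπ S i), ?_, ?_⟩
  · rw [numAxes_canon]
    have := two_mul_numAxes_mkWord hp hπ S
    omega
  · -- run-wise reversal-free: consecutive block letters have different axes
    intro i hi hA heq
    have hax : (canon (mkWord hp π S) ⟨i.val + 1, hi⟩).1 = (canon (mkWord hp π S) i).1 := by rw [heq]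
    have hax' : (mkWord hp π S i).1 = (mkWord hp π S ⟨i.val + 1, hi⟩).1 := ((hst.1 i ⟨i.val + 1, hi⟩).2 hax.symm)
    change axisOf hp π i = axisOf hp π ⟨i.val + 1, hi⟩ at hax'
    rw [axisOf_eq_iff hp hπ] at hax'
    rw [topVec_eq_true_iff] at hA
    rcases hax' with ⟨-, -, h⟩ | ⟨h, -, -⟩
    · simp only at h; omega
    · exact h ⟨hA.1, by omega⟩
  · -- the zero block `[p, p+4)`
    refine ⟨p, p + 4, by omega, hp, fun k hk hk' => (topVec_eq_true_iff k).2 ⟨hk, by omega⟩, ?_⟩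
    rw [wordPos_eq_iff_bsumW (canon (mkWord hp π S)) (by omega) hp]
    have h0 := bsumW_mkWord hp π S
    unfold bsumW at h0 ⊢
    exact (hst.sum_eq_zero_iff _).1 h0

end Member

end WordTypes

end Literature.Probability.RandomPlanarGeometry.SAW.Zd
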